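import Literature.MathematicalPhysics.QuantumFieldTheory.BalabanImbrieJaffe1984to88.BIJ88OneCubeVertexFactors309

/-!
# `BalabanImbrieJaffe1984to88.BIJ88OneCubeSpareShell309` — T. Bałaban, J. Imbrie, A. Jaffe, *Effective action and cluster properties of the abelian
Higgs model*, Commun. Math. Phys. **114** (1988) 257–315 [BalabanImbrieJaffe1988], Sect. 5.14 (5.14.4) p. 309 [PDF 53] with Sect. 5.13 p. 307 [PDF 51]:
**THE ONE-LAW ESTIMATE OF p. 309 WITH A SPARE SHELL POWER AND TWO PER-DERIVATIVE FACTORS** — gen 15's `BIJ88OneCubeVertexFactors309.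
abs_integral_prod_iteratedDeriv_slotFactor_le_pow` (*"|∫ Π_τ (d/dt)^{m_τ} slotFactor_τ dP| ≤ θ^{Σ_τ m_τ}"*) refined in two ways needed by the two-cube
polymers (`BIJ88Ineq5144TwoCubeChi`, same seat and generation): (1) the χ-derivatives and the interaction derivatives get DIFFERENT factors `θ_χ`
(print: `e_k ≤ θ`, p. 309 *"ct^{−n}e^{−cp(te_k)²} ≦ (e^β(L^kε/ε₀)^{1/4−α})ⁿ"*) and `θ_V` (the V-clause); (2) when a χ-slot is differentiated, asking the
regime one order higher (`n₀ + 2 ≤ κ′|log e_k⁻¹|^{2p−1}`, so that the Gaussian shell factor is `≤ (te_k)^{n₀+2}`) leaves ONE factor `e_k` over after all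
`t^{−n}` are cancelled (p. 307, verbatim: *"… and from extremely small factors when a χ′-factor is replaced by 1"*; p. 309, verbatim: *"the coefficient t
in front of V^{(k)}(Y) plus a small power of e_k easily beat the bounds A^{(k)}, φ^{(k)} ≦ cp(e_k)"*).

statement-level skeleton of published theorems with citation tags; proofs where landed; nothing here is a claim about the Yang–Mills mass gap

PDF held: `paper:balaban1988-cmp114-bij-abelian-higgs-effective-action` (journal page = PDF page + 256); pp. 307, 309 re-read this generation (text layer).

WHAT IS PROVED (unit `lit-balaban-p36`, generation 18 of the Phase-2 proof seat p36; SKELETON row **C2.Eq5.14.3-5.14.4** member cell of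
`HOME/lit-balaban-r16/ROWS-C2-part2.md`, owner r16).  Abstract probability space, slot family of gen 15 (`BIJ88SlotMoments308.slotFactor`).
* `shellFactor_le_mul_pow_spare` — `Ĉⁿt^{−n}·Ae^{−κ′p(te_k)²}·e^{K} ≤ e_k·θⁿ` for `n ≤ n₀` once `n₀ + 2 ≤ κ′|log e_k⁻¹|^{2p−1}`, `Ĉ^{n₀}Ae^{K}e_k ≤ 1`,
  `e_k ≤ θ` (gen 15's `shellFactor_le_pow` keeps no spare).
* **`abs_integral_prod_iteratedDeriv_slotFactor_le_spare`** — some χ-slot differentiated: `|∫ Π_τ (d/dt)^{m_τ} slotFactor_τ dP| ≤ e_k·θ_χ^{n_χ}·θ_V^{n_V}`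
  (`n_χ = Σ_b m_b`, `n_V = Σ_Y m_Y`; tails `P{a ≤ |Φ_b|} ≤ Ae^{−κa²}`, thresholds `c_b ≥ c₀ > 0`, `|V(Y)| ≤ K_Y`, `Σ K_Y ≤ K`, `K_Y e^{K} ≤ θ_V`, `e_k ≤ θ_χ`).
* `abs_integral_prod_iteratedDeriv_slotFactor_le_of_inr_pow` — only interaction slots differentiated (`n_V ≥ 1`): `≤ θ_V^{n_V}` (gen 15's second branch).
HONEST SCOPE: one-law Gaussian bookkeeping only; no statement about (5.14.4) itself.  0 `sorry`, 0 definitions, 0 `Prop` facts (D-0026); imports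
`BIJ88OneCubeVertexFactors309` (p36 g15) only; modifies nothing.  NOT summit progress; NOT continuum; NOT Clay.  Cell `lit-balaban` Phase 2, seat p36
gen 18 (owner r16, referee ref-5).
-/

noncomputable section

open Finset MeasureTheory
open Literature.MathematicalPhysics.QuantumFieldTheory.BalabanImbrieJaffe1984to88
open BIJ88Sect2Statements (pLog)
open BIJ88Sect5Statements (CutoffProfile cutoff)
open BIJ88SlotMoments308 (slotFactor)
open BIJ88GaussFactor309 (exp_pLog_sq_le_pow)
open BIJ88OneCubeSlotEstimates309 (integral_abs_prod_iteratedDeriv_slotFactor_le integral_abs_prod_iteratedDeriv_slotFactor_le_of_inr)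
open BIJ88OneCubeVertexFactors309 (tail_threshold_le)

namespace Literature.MathematicalPhysics.QuantumFieldTheory.BalabanImbrieJaffe1984to88.BIJ88OneCubeSpareShell309

/-! ## §1 One-law estimates with a spare shell power and two per-derivative factors -/

section Regime

/-- **p. 309 «ct^{−n}e^{−cp(te_k)²} ≤ θⁿ» WITH ONE POWER TO SPARE**: for `1 ≤ Ĉ`, `0 ≤ A`, `0 ≤ κ′`, `p > 1/2`, `0 < e_k ≤ 1`, `e_k ≤ θ`, `0 < t ≤ 1`,
`n ≤ n₀`, in the regime `n₀ + 2 ≤ κ′|log e_k⁻¹|^{2p−1}` (so that `e^{−κ′p(te_k)²} ≤ (te_k)^{n+2}`), `Ĉ^{n₀}·A·e^{K}·e_k ≤ 1`: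
`Ĉⁿ t^{−n} · A e^{−κ′p(te_k)²} · e^{K} ≤ e_k · θⁿ` (p. 307: *"extremely small factors when a χ′-factor is replaced by 1"*).
[cite: BalabanImbrieJaffe1988, (5.14.4) p.309; p.307 (Sect. 5.13)] -/
theorem shellFactor_le_mul_pow_spare {C A K κ' p ek t θ : ℝ} {n n₀ : ℕ} (hC1 : 1 ≤ C) (hA : 0 ≤ A) (hκ : 0 ≤ κ') (hp : 1 / 2 < p)
    (hek : 0 < ek) (hek1 : ek ≤ 1) (hekθ : ek ≤ θ) (ht : 0 < t) (ht1 : t ≤ 1) (hn : n ≤ n₀)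
    (hreg : (n₀ : ℝ) + 2 ≤ κ' * Real.log ek⁻¹ ^ (2 * p - 1)) (hpre : C ^ n₀ * A * Real.exp K * ek ≤ 1) :
    C ^ n * t⁻¹ ^ n * (A * Real.exp (-(κ' * pLog p (t * ek) ^ 2))) * Real.exp K ≤ ek * θ ^ n := by
  have hx : 0 < t * ek := mul_pos ht hek
  have hxe : t * ek ≤ ek := mul_le_of_le_one_left hek.le ht1
  have hnn : (((n + 1 : ℕ) : ℝ)) + 1 ≤ κ' * Real.log ek⁻¹ ^ (2 * p - 1) := by
    have : (((n + 1 : ℕ) : ℝ)) + 1 ≤ (n₀ : ℝ) + 2 := by push_cast; have := (Nat.cast_le (α := ℝ)).2 hn; linarith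
    exact this.trans hreg
  have h1 : Real.exp (-(κ' * pLog p (t * ek) ^ 2)) ≤ (t * ek) ^ (n + 1 + 1) := exp_pLog_sq_le_pow hx hxe hek1 hp hκ hnn
  have hC0 : 0 < C := by linarith
  have hCn : C ^ n ≤ C ^ n₀ := pow_le_pow_right₀ hC1 hn
  have key : t⁻¹ ^ n * (t * ek) ^ (n + 1 + 1) = t ^ 2 * ek ^ 2 * ek ^ n := by
    rw [mul_pow, pow_add, pow_add, pow_one, inv_pow, ← mul_assoc]
    have : (t ^ n)⁻¹ * (t ^ n * t * t) = t * t := by field_simp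
    calc (t ^ n)⁻¹ * (t ^ n * t * t) * (ek ^ n * ek * ek) = t * t * (ek ^ n * ek * ek) := by rw [this]
      _ = t ^ 2 * ek ^ 2 * ek ^ n := by ring
  have ht2 : t ^ 2 ≤ 1 := pow_le_one₀ ht.le ht1
  have hB : 0 ≤ A * Real.exp K * ek * ek * ek ^ n := by positivity
  calc C ^ n * t⁻¹ ^ n * (A * Real.exp (-(κ' * pLog p (t * ek) ^ 2))) * Real.exp K
      ≤ C ^ n * t⁻¹ ^ n * (A * (t * ek) ^ (n + 1 + 1)) * Real.exp K := by gcongr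
    _ = C ^ n * A * Real.exp K * (t⁻¹ ^ n * (t * ek) ^ (n + 1 + 1)) := by ring
    _ = C ^ n * t ^ 2 * (A * Real.exp K * ek * ek * ek ^ n) := by rw [key]; ring
    _ ≤ C ^ n₀ * 1 * (A * Real.exp K * ek * ek * ek ^ n) :=
        mul_le_mul (mul_le_mul hCn ht2 (by positivity) (pow_nonneg hC0.le _)) le_rfl hB (mul_nonneg (pow_nonneg hC0.le _) zero_le_one)
    _ = (C ^ n₀ * A * Real.exp K * ek) * (ek * ek ^ n) := by ring
    _ ≤ 1 * (ek * ek ^ n) := mul_le_mul_of_nonneg_right hpre (by positivity)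
    _ = ek * ek ^ n := one_mul _
    _ ≤ ek * θ ^ n := mul_le_mul_of_nonneg_left (pow_le_pow_left₀ hek.le hekθ n) hek.le

end Regime

section ThetaForm

variable (χ : CutoffProfile) {ι υ Ω : Type*} [MeasurableSpace Ω] (P : Measure Ω)
variable (p ek : ℝ) (B : Finset ι) (Φ : ι → Ω → ℝ) (c : ι → ℝ) (Ys : Finset υ) (V : υ → Ω → ℝ)

/-- **(5.14.4) FOR ONE LAW, A χ-SLOT DIFFERENTIATED, TWO PER-DERIVATIVE FACTORS AND A SPARE `e_k`** (p. 309: *"Each t-derivative of a χ-factor … gives at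
least a factor e^β(L^kε/ε₀)^{1/4−α} … Each factor V^{(k)}(Y) in Π (d/dt)_{γ_j} produces a factor …"*): on a probability space, for a slot family with
measurable slot fields `Φ_b` whose tails satisfy `P{a ≤ |Φ_b|} ≤ A e^{−κa²}`, thresholds `c_b ≥ c₀ > 0`, terms `|V(Y)| ≤ K_Y` with `0 ≤ K_Y`, `Σ_Y K_Y ≤ K`,
derivative numbers `m_τ` with `Σ_τ m_τ ≤ n₀` and SOME χ-slot differentiated, `0 < t ≤ 1`, `0 < e_k ≤ e⁻¹`, in the regime `e_k ≤ θ_χ`,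
`n₀ + 2 ≤ κ(81/100)c₀²|log e_k⁻¹|^{2p−1}`, `Ĉ^{n₀}Ae^{K}e_k ≤ 1`, `K_Y e^{K} ≤ θ_V`:
`|∫ Π_τ (d/dt)^{m_τ} slotFactor_τ dP| ≤ e_k · θ_χ^{Σ_b m_b} · θ_V^{Σ_Y m_Y}`. [cite: BalabanImbrieJaffe1988, (5.14.4) p.309; p.307 (Sect. 5.13)] -/
theorem abs_integral_prod_iteratedDeriv_slotFactor_le_spare [IsProbabilityMeasure P] {C : ℝ} (hC1 : 1 ≤ C) {n₀ : ℕ}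
    (hC : ∀ i, i ≤ n₀ → ∀ (A : ℝ) ⦃q ek t : ℝ⦄, q ≠ 0 → 0 < ek → 0 < t → t * ek ≤ Real.exp (-1) →
      |iteratedDeriv i (fun s => cutoff χ (q * pLog p (s * ek)) A) t| ≤ C * t ^ (-(i : ℤ)))
    (hp : 1 / 2 < p) {t : ℝ} (hek : 0 < ek) (hek1 : ek ≤ Real.exp (-1)) (ht : 0 < t) (ht1 : t ≤ 1)
    (T : Finset (↥B ⊕ ↥Ys)) (m : ↥B ⊕ ↥Ys → ℕ) (hm : ∑ τ ∈ T, m τ ≤ n₀) (hex : ∃ b₀ ∈ T.toLeft, 1 ≤ m (Sum.inl b₀))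
    {c₀ : ℝ} (hc₀ : 0 < c₀) (hcb : ∀ b ∈ T.toLeft, c₀ ≤ c b)
    (KY : υ → ℝ) (hK : ∀ Y ∈ T.toRight, ∀ ω, |V Y ω| ≤ KY Y) (hKY0 : ∀ Y ∈ T.toRight, 0 ≤ KY Y) {K : ℝ}
    (hKsum : ∑ Y ∈ T.toRight, KY Y ≤ K) (hΦ : ∀ b ∈ T.toLeft, Measurable (Φ b))
    {A κ : ℝ} (hA : 0 ≤ A) (hκ : 0 ≤ κ) (htail : ∀ b ∈ T.toLeft, ∀ a, 0 ≤ a → P.real {ω | a ≤ |Φ b ω|} ≤ A * Real.exp (-(κ * a ^ 2)))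
    {θχ θV : ℝ} (hekθ : ek ≤ θχ) (hreg : (n₀ : ℝ) + 2 ≤ κ * (81 / 100) * c₀ ^ 2 * Real.log ek⁻¹ ^ (2 * p - 1))
    (hpre : C ^ n₀ * A * Real.exp K * ek ≤ 1) (hKθ : ∀ Y ∈ T.toRight, KY Y * Real.exp K ≤ θV) :
    |∫ ω, ∏ τ ∈ T, iteratedDeriv (m τ) (slotFactor χ p ek B Φ c Ys V ω τ) t ∂P| ≤
      ek * θχ ^ (∑ b ∈ T.toLeft, m (Sum.inl b)) * θV ^ (∑ Y ∈ T.toRight, m (Sum.inr Y)) := by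
  have h1 : t * ek ≤ Real.exp (-1) := (mul_le_of_le_one_left hek.le ht1).trans hek1
  have hek1' : ek ≤ 1 := hek1.trans (Real.exp_le_one_iff.mpr (by norm_num))
  have hC0 : 0 < C := by linarith
  have hcbne : ∀ b ∈ T.toLeft, c b ≠ 0 := fun b hb => (hc₀.trans_le (hcb b hb)).ne'
  have hK0 : 0 ≤ K := (sum_nonneg hKY0).trans hKsum
  have hsum : ∑ τ ∈ T, m τ = (∑ b ∈ T.toLeft, m (Sum.inl b)) + ∑ Y ∈ T.toRight, m (Sum.inr Y) :=
    Finset.sum_sum_eq_sum_toLeft_add_sum_toRight T m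
  set nχ := ∑ b ∈ T.toLeft, m (Sum.inl b) with hnχ
  set nV := ∑ Y ∈ T.toRight, m (Sum.inr Y) with hnV
  have hle : nχ + nV ≤ n₀ := hsum ▸ hm
  obtain ⟨b₀, hb₀, hmb₀⟩ := hex
  -- the interaction derivatives: `Π K_Y^{m_Y} ≤ θ_V^{n_V} e^{−K n_V}`
  have hθV0 : T.toRight.Nonempty → 0 ≤ θV := fun ⟨Y, hY⟩ => le_trans (mul_nonneg (hKY0 Y hY) (Real.exp_pos _).le) (hKθ Y hY)
  have hKYθ : ∀ Y ∈ T.toRight, KY Y ≤ θV * Real.exp (-K) := fun Y hY => by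
    rw [Real.exp_neg, ← div_eq_mul_inv, le_div_iff₀ (Real.exp_pos K)]; exact hKθ Y hY
  have hprodY : ∏ Y ∈ T.toRight, KY Y ^ m (Sum.inr Y) ≤ θV ^ nV * Real.exp (-K) ^ nV := by
    rw [← mul_pow, hnV, ← prod_pow_eq_pow_sum]
    exact prod_le_prod (fun Y hY => pow_nonneg (hKY0 Y hY) _) fun Y hY => pow_le_pow_left₀ (hKY0 Y hY) (hKYθ Y hY) _
  have hexpK : Real.exp (∑ Y ∈ T.toRight, KY Y) ≤ Real.exp K := Real.exp_le_exp.mpr hKsum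
  have hP1 : Real.exp (-K) ^ nV ≤ 1 := pow_le_one₀ (Real.exp_pos _).le (Real.exp_le_one_iff.mpr (neg_nonpos.mpr hK0))
  -- the χ-derivatives: the Gaussian shell factor of `b₀`, with one power to spare
  have hmχ : ∀ b ∈ T.toLeft, m (Sum.inl b) ≤ n₀ := fun b hb =>
    ((single_le_sum (f := fun b => m (Sum.inl b)) (fun _ _ => Nat.zero_le _) hb).trans (Nat.le_add_right _ _)).trans hle
  have hnχn : nχ ≤ n₀ := (Nat.le_add_right _ _).trans hle
  have hI := integral_abs_prod_iteratedDeriv_slotFactor_le χ P p ek B Φ c Ys V hC1 hC hek ht ht1 h1 T m hmχ hcbne KY hK hKY0 hΦ hb₀ hmb₀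
  have hSle := tail_threshold_le P p ek Φ c (t := t) hc₀ (hcb b₀ hb₀) hA hκ (htail b₀ hb₀)
  have hshell := shellFactor_le_mul_pow_spare (K := K) hC1 hA (by positivity : 0 ≤ κ * (81 / 100) * c₀ ^ 2) hp hek hek1' hekθ ht ht1 hnχn hreg hpre
  have hθVn : 0 ≤ θV ^ nV := by
    rcases T.toRight.eq_empty_or_nonempty with h0 | hne
    · have : nV = 0 := by rw [hnV, h0, sum_empty]
      rw [this, pow_zero]; exact zero_le_one
    · exact pow_nonneg (hθV0 hne) _
  have hθχ0 : 0 ≤ θχ := hek.le.trans hekθ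
  have hnn : 0 ≤ ek * θχ ^ nχ * θV ^ nV := mul_nonneg (mul_nonneg hek.le (pow_nonneg hθχ0 _)) hθVn
  have hX0 : 0 ≤ C ^ nχ * t⁻¹ ^ nχ * (A * Real.exp (-(κ * (81 / 100) * c₀ ^ 2 * pLog p (t * ek) ^ 2))) * Real.exp K := by positivity
  refine abs_integral_le_integral_abs.trans ?_
  calc ∫ ω, |∏ τ ∈ T, iteratedDeriv (m τ) (slotFactor χ p ek B Φ c Ys V ω τ) t| ∂P
      ≤ C ^ nχ * t⁻¹ ^ nχ * ((∏ Y ∈ T.toRight, KY Y ^ m (Sum.inr Y)) * Real.exp (∑ Y ∈ T.toRight, KY Y)) *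
          P.real {ω | 9 / 10 * (|c b₀| * pLog p (t * ek)) ≤ |Φ b₀ ω|} := hI
    _ ≤ C ^ nχ * t⁻¹ ^ nχ * ((θV ^ nV * Real.exp (-K) ^ nV) * Real.exp K) *
          (A * Real.exp (-(κ * (81 / 100) * c₀ ^ 2 * pLog p (t * ek) ^ 2))) := by gcongr
    _ = (C ^ nχ * t⁻¹ ^ nχ * (A * Real.exp (-(κ * (81 / 100) * c₀ ^ 2 * pLog p (t * ek) ^ 2))) * Real.exp K) *
          (θV ^ nV * Real.exp (-K) ^ nV) := by ring
    _ ≤ (ek * θχ ^ nχ) * (θV ^ nV * 1) :=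
        mul_le_mul hshell (mul_le_mul_of_nonneg_left hP1 hθVn) (mul_nonneg hθVn (pow_nonneg (Real.exp_pos _).le _))
          (mul_nonneg hek.le (pow_nonneg hθχ0 _))
    _ = ek * θχ ^ nχ * θV ^ nV := by ring

/-- **ONLY INTERACTION SLOTS DIFFERENTIATED, AS A POWER OF THE V-FACTOR**: all `m_b = 0` on χ-slots, `1 ≤ Σ_Y m_Y`, `|V(Y)| ≤ K_Y`, `0 ≤ K_Y`,
`Σ_Y K_Y ≤ K`, `K_Y e^{K} ≤ θ_V`: `|∫ Π_τ (d/dt)^{m_τ} slotFactor_τ dP| ≤ θ_V^{Σ_Y m_Y}` (p. 309: *"Each factor V^{(k)}(Y) in Π (d/dt)_{γ_j} produces a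
factor e^β(L^kε/ε₀)^{1/4−α}"*). [cite: BalabanImbrieJaffe1988, (5.14.4) p.309] -/
theorem abs_integral_prod_iteratedDeriv_slotFactor_le_of_inr_pow [IsProbabilityMeasure P]
    {t : ℝ} (hek : 0 < ek) (hek1 : ek ≤ Real.exp (-1)) (ht : 0 < t) (ht1 : t ≤ 1)
    (T : Finset (↥B ⊕ ↥Ys)) (m : ↥B ⊕ ↥Ys → ℕ) (hm0 : ∀ b ∈ T.toLeft, m (Sum.inl b) = 0) (hm1 : 1 ≤ ∑ Y ∈ T.toRight, m (Sum.inr Y))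
    {c₀ : ℝ} (hc₀ : 0 < c₀) (hcb : ∀ b ∈ T.toLeft, c₀ ≤ c b)
    (KY : υ → ℝ) (hK : ∀ Y ∈ T.toRight, ∀ ω, |V Y ω| ≤ KY Y) (hKY0 : ∀ Y ∈ T.toRight, 0 ≤ KY Y) {K : ℝ}
    (hKsum : ∑ Y ∈ T.toRight, KY Y ≤ K) {θV : ℝ} (hKθ : ∀ Y ∈ T.toRight, KY Y * Real.exp K ≤ θV) :
    |∫ ω, ∏ τ ∈ T, iteratedDeriv (m τ) (slotFactor χ p ek B Φ c Ys V ω τ) t ∂P| ≤ θV ^ (∑ Y ∈ T.toRight, m (Sum.inr Y)) := by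
  have h1 : t * ek ≤ Real.exp (-1) := (mul_le_of_le_one_left hek.le ht1).trans hek1
  have hcbne : ∀ b ∈ T.toLeft, c b ≠ 0 := fun b hb => (hc₀.trans_le (hcb b hb)).ne'
  have hK0 : 0 ≤ K := (sum_nonneg hKY0).trans hKsum
  have hne : T.toRight.Nonempty := by
    by_contra h0
    rw [not_nonempty_iff_eq_empty] at h0
    rw [h0, sum_empty] at hm1
    exact absurd hm1 (by norm_num)
  set nV := ∑ Y ∈ T.toRight, m (Sum.inr Y) with hnV
  obtain ⟨Y₀, hY₀⟩ := hne
  have hθV0 : 0 ≤ θV := le_trans (mul_nonneg (hKY0 Y₀ hY₀) (Real.exp_pos _).le) (hKθ Y₀ hY₀)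
  have hKYθ : ∀ Y ∈ T.toRight, KY Y ≤ θV * Real.exp (-K) := fun Y hY => by
    rw [Real.exp_neg, ← div_eq_mul_inv, le_div_iff₀ (Real.exp_pos K)]; exact hKθ Y hY
  have hprodY : ∏ Y ∈ T.toRight, KY Y ^ m (Sum.inr Y) ≤ θV ^ nV * Real.exp (-K) ^ nV := by
    rw [← mul_pow, hnV, ← prod_pow_eq_pow_sum]
    exact prod_le_prod (fun Y hY => pow_nonneg (hKY0 Y hY) _) fun Y hY => pow_le_pow_left₀ (hKY0 Y hY) (hKYθ Y hY) _
  have hexpK : Real.exp (∑ Y ∈ T.toRight, KY Y) ≤ Real.exp K := Real.exp_le_exp.mpr hKsum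
  have hnV1 : (1 : ℝ) ≤ nV := by exact_mod_cast hm1
  have heK1 : Real.exp (-K) ^ nV * Real.exp K ≤ 1 := by
    rw [← Real.exp_nat_mul, ← Real.exp_add, Real.exp_le_one_iff]
    nlinarith
  have hI := integral_abs_prod_iteratedDeriv_slotFactor_le_of_inr χ P p ek B Φ c Ys V hek ht ht1 h1 T m hm0 hcbne KY hK
  refine abs_integral_le_integral_abs.trans ?_
  calc ∫ ω, |∏ τ ∈ T, iteratedDeriv (m τ) (slotFactor χ p ek B Φ c Ys V ω τ) t| ∂P
      ≤ (∏ Y ∈ T.toRight, KY Y ^ m (Sum.inr Y)) * Real.exp (∑ Y ∈ T.toRight, KY Y) := hI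
    _ ≤ (θV ^ nV * Real.exp (-K) ^ nV) * Real.exp K := by gcongr
    _ = θV ^ nV * (Real.exp (-K) ^ nV * Real.exp K) := by ring
    _ ≤ θV ^ nV * 1 := mul_le_mul_of_nonneg_left heK1 (pow_nonneg hθV0 _)
    _ = θV ^ nV := mul_one _

end ThetaForm

end Literature.MathematicalPhysics.QuantumFieldTheory.BalabanImbrieJaffe1984to88.BIJ88OneCubeSpareShell309

end
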